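import Mathlib
import Literature.MathematicalPhysics.StatisticalMechanics.Crystallization

/-!
# BC5 rung for crux `CrystalliteCase` (node N_C.A.2.2 CrystalliteDichotomy, decomp-a2c lens 2, gen 7) — the ROBUST-POTENTIAL LEMMA

The pointwise inequality behind the gap certificates of the door of T_X: with the tree potential V(r) = r⁻¹²/12 − r⁻⁶/6 and the smearing
width 2ε₀ = 1/500, the robust value
    Vrob(r) = V(r + 1/500) if r + 1/500 ≤ 1;  V(r − 1/500) if r − 1/500 ≥ 1;  −1/12 otherwise
satisfies Vrob(r) ≤ V(r') for every r' > 0 with |r' − r| ≤ 1/500.  Hence the certified robust lattice sums of a template bound from below the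
actual interior site energies of any 1/1000-matched grain (registered stub `stub_rung_robustPotential` of bc/CrystalliteCase_birth.lean).
No sorry.
-/

namespace Summit.AtomisticToContinuum.Crystallization.Theorems.CrystalliteDichotomyCrystalliteCaseRung

open Literature.MathematicalPhysics.StatisticalMechanics

/-! Monotonicity of V on (0, 1] and [1, ∞) is landed elsewhere (`PhononSlackCertificatesNearFarGlueR.lennardJones_le_of_le_one`,
`NearFarGlueRNegative.lennardJones_mono_of_one_le`); to keep this rung's imports at the Literature level the two one-line monotonicity facts are
re-derived INSIDE the proof (local `have`s, no restated declarations) from V(a) − V(b) = (a⁻⁶ − b⁻⁶)(a⁻⁶ + b⁻⁶ − 2)/12. -/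

/-- **The robust-potential lemma** (BC5 rung of `CrystalliteCase`; = the registered stub `stub_rung_robustPotential` of the birth skeleton
bc/CrystalliteCase_birth.lean, by name and signature). -/
theorem stub_rung_robustPotential :
    ∀ r r' : ℝ, 0 < r' → |r' - r| ≤ 1 / 500 → (if r + 1 / 500 ≤ 1 then Literature.MathematicalPhysics.StatisticalMechanics.lennardJones (r + 1 / 500) else if 1 ≤ r - 1 / 500 then Literature.MathematicalPhysics.StatisticalMechanics.lennardJones (r - 1 / 500) else -(1 / 12 : ℝ)) ≤ Literature.MathematicalPhysics.StatisticalMechanics.lennardJones r' := by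
  intro r r' hr' habs
  obtain ⟨hlo, hhi⟩ := abs_le.mp habs
  have hsub : ∀ a b : ℝ, lennardJones a - lennardJones b = ((a⁻¹) ^ 6 - (b⁻¹) ^ 6) * ((a⁻¹) ^ 6 + (b⁻¹) ^ 6 - 2) / 12 := by
    intro a b; unfold lennardJones; ring
  split_ifs with h1 h2
  · -- repulsive branch: 0 < r' ≤ r + 1/500 ≤ 1, V decreasing on (0, 1]
    have hab : r' ≤ r + 1 / 500 := by linarith
    have hb0 : 0 < r + 1 / 500 := lt_of_lt_of_le hr' hab
    have i1 : (r + 1 / 500)⁻¹ ≤ r'⁻¹ := by rw [inv_le_inv₀ hb0 hr']; exact hab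
    have i2 : (1 : ℝ) ≤ (r + 1 / 500)⁻¹ := by rw [one_le_inv₀ hb0]; exact h1
    have i3 : ((r + 1 / 500)⁻¹) ^ 6 ≤ (r'⁻¹) ^ 6 := pow_le_pow_left₀ (by positivity) i1 6
    have i4 : (1 : ℝ) ≤ ((r + 1 / 500)⁻¹) ^ 6 := one_le_pow₀ i2
    have i5 : 0 ≤ ((r'⁻¹) ^ 6 - ((r + 1 / 500)⁻¹) ^ 6) * ((r'⁻¹) ^ 6 + ((r + 1 / 500)⁻¹) ^ 6 - 2) / 12 :=
      div_nonneg (mul_nonneg (by linarith) (by linarith)) (by norm_num)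
    have i6 := hsub r' (r + 1 / 500)
    linarith
  · -- attractive branch: 1 ≤ r − 1/500 ≤ r', V increasing on [1, ∞)
    have hab : r - 1 / 500 ≤ r' := by linarith
    have ha0 : 0 < r - 1 / 500 := by linarith
    have i1 : r'⁻¹ ≤ (r - 1 / 500)⁻¹ := by rw [inv_le_inv₀ hr' ha0]; exact hab
    have i2 : (r - 1 / 500)⁻¹ ≤ 1 := inv_le_one_of_one_le₀ h2
    have i3 : (r'⁻¹) ^ 6 ≤ ((r - 1 / 500)⁻¹) ^ 6 := pow_le_pow_left₀ (by positivity) i1 6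
    have i4 : ((r - 1 / 500)⁻¹) ^ 6 ≤ 1 := pow_le_one₀ (by positivity) i2
    have i5 : (((r - 1 / 500)⁻¹) ^ 6 - (r'⁻¹) ^ 6) * (((r - 1 / 500)⁻¹) ^ 6 + (r'⁻¹) ^ 6 - 2) / 12 ≤ 0 :=
      div_nonpos_of_nonpos_of_nonneg (mul_nonpos_of_nonneg_of_nonpos (by linarith) (by linarith)) (by norm_num)
    have i6 := hsub (r - 1 / 500) r'
    linarith
  · have := neg_one_div_le_lennardJones r'
    linarith
end Summit.AtomisticToContinuum.Crystallization.Theorems.CrystalliteDichotomyCrystalliteCaseRung
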